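import Mathlib
import HarnessLib.Audit
import Summits.PneNP.PneNP.Theorems.PstarFreshEraseTerminal

/-!
# Fresh gates are erasable, III: the corollary — fresh-gated terminal cores have at most five outputs (ROUND-24, memo §14.3; ASK T-O2-G (G1))

FRONTIER range-avoidance ladder, rung F-N3, ROUND 24 (cell `pnp-ideate`, planner memo `r24/CORE-BOUND-NOTES.md` §14.3, ASK T-O2-G (G1) of planner p3 g21,
typed sketch `r24/SketchUnion.lean` statement `card_le_five_of_freshGates` verbatim; restricted-model proof complexity — nothing here bears on `P`
versus `NP`).

* `terminal_symm` — the terminal-core conditions are symmetric in the two constraints;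
* `freshGate_mono` — freshness survives erasing OTHER monomials;
* `card_le_five_of_freshGates` — **(G1)**: a terminal core with Assumption-A data `F` in which every monomial touching an AND variable of a chord
  does so in slot 2, as a once-used FRESH gate (in `w₁`, or in `w₂` with the roles swapped), and is the only monomial touching that chord, has at most
  FIVE outputs.  Induction on the number of monomials: erase one gate by `PstarFreshEraseTerminal.terminal_eraseGate` (after `terminal_symm` if it
  sits in `w₂`), the hypotheses persist (`freshGate_mono`); with no gate left, privates are unread and `PstarCoreBoundTargets.card_le_five_of_terminal'`
  (the landed R-chain) applies.
-/

set_option linter.dupNamespace false -- `Summit.PneNP.PneNP.…`: summit = sub-problem name (D-0017 single-conjunct layout)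

open Finset Literature.Computability.Complexity
open Summit.PneNP.PneNP.Theorems.PstarTyped (Typed)
open Summit.PneNP.PneNP.Theorems.PstarSALevel (varSet bdry BoundaryExpanding SimpleOverlap)
open Summit.PneNP.PneNP.Theorems.PstarGapOneAll (gval)
open Summit.PneNP.PneNP.Theorems.PstarCoreBound (XorClosed)
open Summit.PneNP.PneNP.Theorems.PstarChordRepair (IsChord)
open Summit.PneNP.PneNP.Theorems.PstarChordBridgeCotree (Peelable)
open Summit.PneNP.PneNP.Theorems.PstarChordBridgeTools (privs mem_privs)
open Summit.PneNP.PneNP.Theorems.PstarCoreBoundTargets (Terminal card_le_five_of_terminal')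
open Summit.PneNP.PneNP.Theorems.PstarFreshErase (FreshGate eraseGate)
open Summit.PneNP.PneNP.Theorems.PstarFreshEraseTerminal (terminal_eraseGate)

namespace Summit.PneNP.PneNP.Theorems.PstarFreshEraseGates

variable {n m : ℕ}

/-! ## Symmetry and monotonicity -/

/-- **The terminal-core conditions are symmetric in the two constraints.** -/
theorem terminal_symm {I : LocalMap 4 n m} {r : ℕ} {y : Fin m → Bool} {J₀ : Finset (Fin m)}
    {w₁ w₂ : Finset (Fin n) × Finset (Fin m) × Bool} (h : Terminal I r y J₀ w₁ w₂) : Terminal I r y J₀ w₂ w₁ := by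
  obtain ⟨hne, hX, hJr, hd₁, hd₂, hr, hT3, hM0⟩ := h
  refine ⟨hne, hX, hJr, hd₂, hd₁, ?_, ?_, ?_⟩
  · rwa [union_assoc, union_comm w₂.2.1, ← union_assoc]
  · rintro ⟨x, hx, h2, h1⟩
    exact hT3 ⟨x, hx, h1, h2⟩
  · intro f hf
    obtain ⟨x, hx, h1, h2⟩ := hM0 f hf
    exact ⟨x, hx, h2, h1⟩

/-- **Freshness survives erasing other monomials** (same linear parts, fewer monomials, the gate kept). -/
theorem freshGate_mono {I : LocalMap 4 n m} {J₀ : Finset (Fin m)} {w₁ w₂ w₁' w₂' : Finset (Fin n) × Finset (Fin m) × Bool} {g : Fin m}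
    {p z : Fin n} (h : FreshGate I J₀ w₁ w₂ g p z) (h₁ : w₁'.1 = w₁.1) (h₂ : w₂'.1 = w₂.1) (hg : g ∈ w₁'.2.1)
    (hG₁ : w₁'.2.1 ⊆ w₁.2.1) (hG₂ : w₂'.2.1 ⊆ w₂.2.1) : FreshGate I J₀ w₁' w₂' g p z := by
  obtain ⟨-, hg₂, h2, h3, hpz, hJ, hC₁, hC₂, hoth⟩ := h
  refine ⟨hg, fun h => hg₂ (hG₂ h), h2, h3, hpz, hJ, h₁ ▸ hC₁, h₂ ▸ hC₂, fun g' hg' hne => hoth g' ?_ hne⟩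
  rcases mem_union.1 hg' with h | h
  · exact mem_union_left _ (hG₁ h)
  · exact mem_union_right _ (hG₂ h)

/-! ## The fresh-gate hypothesis and its bookkeeping -/

/-- The hypothesis of (G1) on the monomials of `(w₁, w₂)`: every monomial touching an AND variable of a chord `e ∈ J₀ ∖ F` does so in slot 2, as a
fresh gate (in `w₁`, or in `w₂` with the roles swapped), and is the only monomial touching `e`. -/
def FreshGates (I : LocalMap 4 n m) (J₀ F : Finset (Fin m)) (w₁ w₂ : Finset (Fin n) × Finset (Fin m) × Bool) : Prop :=
  ∀ g ∈ w₁.2.1 ∪ w₂.2.1, ∀ e ∈ J₀ \ F, ∀ s : Fin 4, 2 ≤ s.val → (I.vars g s = I.vars e 2 ∨ I.vars g s = I.vars e 3) →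
    s = 2 ∧ (∃ z, (g ∈ w₁.2.1 ∧ FreshGate I J₀ w₁ w₂ g (I.vars g 2) z) ∨ (g ∈ w₂.2.1 ∧ FreshGate I J₀ w₂ w₁ g (I.vars g 2) z)) ∧
    (∀ g' ∈ w₁.2.1 ∪ w₂.2.1, g' ≠ g → ∀ s' : Fin 4, 2 ≤ s'.val → I.vars g' s' ≠ I.vars e 2 ∧ I.vars g' s' ≠ I.vars e 3)

/-- The hypothesis is symmetric in the two constraints. -/
theorem freshGates_symm {I : LocalMap 4 n m} {J₀ F : Finset (Fin m)} {w₁ w₂ : Finset (Fin n) × Finset (Fin m) × Bool}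
    (h : FreshGates I J₀ F w₁ w₂) : FreshGates I J₀ F w₂ w₁ := by
  intro g hg e he s hs htouch
  rw [union_comm] at hg
  obtain ⟨hs2, ⟨z, hz⟩, halone⟩ := h g hg e he s hs htouch
  refine ⟨hs2, ⟨z, hz.symm⟩, fun g' hg' => halone g' (by rwa [union_comm] at hg')⟩

/-- The hypothesis survives erasing a monomial of `w₁`. -/
theorem freshGates_erase {I : LocalMap 4 n m} {J₀ F : Finset (Fin m)} {w₁ w₂ : Finset (Fin n) × Finset (Fin m) × Bool}
    (h : FreshGates I J₀ F w₁ w₂) (g₀ : Fin m) (hg₀ : g₀ ∉ w₂.2.1) : FreshGates I J₀ F (eraseGate w₁ g₀) w₂ := by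
  intro g hg e he s hs htouch
  have hsub : (eraseGate w₁ g₀).2.1 ∪ w₂.2.1 ⊆ w₁.2.1 ∪ w₂.2.1 := union_subset_union (erase_subset g₀ _) (Subset.refl _)
  have hgne : g ≠ g₀ := by
    rintro rfl
    rcases mem_union.1 hg with h' | h'
    · exact notMem_erase _ _ h'
    · exact hg₀ h'
  obtain ⟨hs2, ⟨z, hz⟩, halone⟩ := h g (hsub hg) e he s hs htouch
  refine ⟨hs2, ⟨z, ?_⟩, fun g' hg' => halone g' (hsub hg')⟩
  rcases hz with ⟨hg₁, hF⟩ | ⟨hg₂, hF⟩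
  · exact Or.inl ⟨mem_erase.2 ⟨hgne, hg₁⟩, freshGate_mono hF rfl rfl (mem_erase.2 ⟨hgne, hg₁⟩) (erase_subset g₀ _) (Subset.refl _)⟩
  · exact Or.inr ⟨hg₂, freshGate_mono hF rfl rfl hg₂ (Subset.refl _) (erase_subset g₀ _)⟩

/-! ## (G1) The corollary -/

/-- **(G1) induction form**: terminal + fresh-gated ⟹ at most five outputs, by induction on the number of monomials. -/
theorem card_le_five_of_freshGates_aux {r : ℕ} (I : LocalMap 4 n m) (hI : I.IsPure xorAndPred) (hT : Typed I) (hS : SimpleOverlap I)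
    (hB : BoundaryExpanding r I) {y : Fin m → Bool} {J₀ : Finset (Fin m)} {F : Finset (Fin m)} (hF : F ⊆ J₀) (hP : Peelable I F)
    (hmax : ∀ F', F ⊆ F' → F' ⊆ J₀ → Peelable I F' → F' = F) (hchord : ∀ e ∈ J₀ \ F, IsChord I J₀ e)
    (hne : ∀ e ∈ J₀ \ F, I.vars e 2 ≠ I.vars e 3) :
    ∀ (N : ℕ) (w₁ w₂ : Finset (Fin n) × Finset (Fin m) × Bool), w₁.2.1.card + w₂.2.1.card ≤ N → Terminal I r y J₀ w₁ w₂ →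
      FreshGates I J₀ F w₁ w₂ → J₀.card ≤ 5 := by
  classical
  -- one erasure step, for a gate in the FIRST constraint
  have step : ∀ (w₁ w₂ : Finset (Fin n) × Finset (Fin m) × Bool) (g : Fin m) (z : Fin n) (e : Fin m), Terminal I r y J₀ w₁ w₂ →
      FreshGates I J₀ F w₁ w₂ → e ∈ J₀ \ F → I.vars g 2 = I.vars e 2 ∨ I.vars g 2 = I.vars e 3 → FreshGate I J₀ w₁ w₂ g (I.vars g 2) z →
      (∀ g' ∈ w₁.2.1 ∪ w₂.2.1, g' ≠ g → ∀ s' : Fin 4, 2 ≤ s'.val → I.vars g' s' ≠ I.vars e 2 ∧ I.vars g' s' ≠ I.vars e 3) →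
      Terminal I r y J₀ (eraseGate w₁ g) w₂ ∧ FreshGates I J₀ F (eraseGate w₁ g) w₂ ∧
        (eraseGate w₁ g).2.1.card + w₂.2.1.card < w₁.2.1.card + w₂.2.1.card := by
    intro w₁ w₂ g z e ht hfr he htouch hFg halone
    have hpe : I.vars e 2 = I.vars g 2 ∨ I.vars e 3 = I.vars g 2 := by
      rcases htouch with h | h
      · exact Or.inl h.symm
      · exact Or.inr h.symm
    refine ⟨terminal_eraseGate I hI hT hS hB hFg (mem_sdiff.1 he).1 hpe (hne e he) (hchord e he) halone ht, freshGates_erase hfr g hFg.2.1, ?_⟩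
    have : (w₁.2.1.erase g).card < w₁.2.1.card := card_erase_lt_of_mem hFg.1
    show (w₁.2.1.erase g).card + w₂.2.1.card < w₁.2.1.card + w₂.2.1.card
    omega
  intro N
  induction N with
  | zero =>
    intro w₁ w₂ hN ht hfr
    -- no monomials at all: privates unread
    have h₁ : w₁.2.1 = ∅ := card_eq_zero.1 (by omega)
    have h₂ : w₂.2.1 = ∅ := card_eq_zero.1 (by omega)
    refine card_le_five_of_terminal' I hI hT hS hB y ht hF hP hmax hchord fun g hg => ?_
    rw [h₁, h₂, union_empty] at hg
    exact absurd hg (notMem_empty g)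
  | succ N ih =>
    intro w₁ w₂ hN ht hfr
    by_cases hviol : ∃ g ∈ w₁.2.1 ∪ w₂.2.1, ∃ e ∈ J₀ \ F, ∃ s : Fin 4, 2 ≤ s.val ∧ (I.vars g s = I.vars e 2 ∨ I.vars g s = I.vars e 3)
    · obtain ⟨g, hg, e, he, s, hs, htouch⟩ := hviol
      obtain ⟨hs2, ⟨z, hz⟩, halone⟩ := hfr g hg e he s hs htouch
      subst hs2
      rcases hz with ⟨-, hFg⟩ | ⟨-, hFg⟩
      · obtain ⟨ht', hfr', hlt⟩ := step w₁ w₂ g z e ht hfr he htouch hFg halone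
        exact ih _ _ (by omega) ht' hfr'
      · have halone' : ∀ g' ∈ w₂.2.1 ∪ w₁.2.1, g' ≠ g → ∀ s' : Fin 4, 2 ≤ s'.val → I.vars g' s' ≠ I.vars e 2 ∧ I.vars g' s' ≠ I.vars e 3 :=
          fun g' hg' => halone g' (by rwa [union_comm] at hg')
        obtain ⟨ht', hfr', hlt⟩ := step w₂ w₁ g z e (terminal_symm ht) (freshGates_symm hfr) he htouch hFg halone'
        exact ih _ _ (by omega) ht' hfr'
    · -- no monomial touches a chord variable: privates unread
      refine card_le_five_of_terminal' I hI hT hS hB y ht hF hP hmax hchord fun g hg v hv => ?_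
      obtain ⟨e, he, hev⟩ := (mem_privs I).1 hv
      by_contra hc
      rw [not_and_or, not_not, not_not] at hc
      apply hviol
      refine ⟨g, hg, e, he, ?_⟩
      rcases hc with h | h
      · refine ⟨2, by decide, ?_⟩
        rcases hev with h' | h'
        · exact Or.inl (h.trans h'.symm)
        · exact Or.inr (h.trans h'.symm)
      · refine ⟨3, by decide, ?_⟩
        rcases hev with h' | h'
        · exact Or.inl (h.trans h'.symm)
        · exact Or.inr (h.trans h'.symm)

/-- **(G1) COROLLARY OF FRESH ERASE.**  If every monomial of `w₁, w₂` that touches an AND variable of a chord is a once-used fresh gate ON that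
variable (slot 2 = the chord variable, slot 3 = the fresh partner) and each chord is touched by at most one monomial, the terminal core has at most five
members (p3's statement verbatim). -/
theorem card_le_five_of_freshGates {r : ℕ} (I : LocalMap 4 n m) (hI : I.IsPure xorAndPred) (hT : Typed I) (hS : SimpleOverlap I)
    (hB : BoundaryExpanding r I) {y : Fin m → Bool} {J₀ : Finset (Fin m)} {w₁ w₂ : Finset (Fin n) × Finset (Fin m) × Bool}
    (ht : Terminal I r y J₀ w₁ w₂) {F : Finset (Fin m)} (hF : F ⊆ J₀) (hP : Peelable I F)
    (hmax : ∀ F', F ⊆ F' → F' ⊆ J₀ → Peelable I F' → F' = F) (hchord : ∀ e ∈ J₀ \ F, IsChord I J₀ e)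
    (hne : ∀ e ∈ J₀ \ F, I.vars e 2 ≠ I.vars e 3)
    (hfresh : ∀ g ∈ w₁.2.1 ∪ w₂.2.1, ∀ e ∈ J₀ \ F, ∀ s : Fin 4, 2 ≤ s.val → (I.vars g s = I.vars e 2 ∨ I.vars g s = I.vars e 3) →
      s = 2 ∧ (∃ z, (g ∈ w₁.2.1 ∧ FreshGate I J₀ w₁ w₂ g (I.vars g 2) z) ∨ (g ∈ w₂.2.1 ∧ FreshGate I J₀ w₂ w₁ g (I.vars g 2) z)) ∧
      (∀ g' ∈ w₁.2.1 ∪ w₂.2.1, g' ≠ g → ∀ s' : Fin 4, 2 ≤ s'.val → I.vars g' s' ≠ I.vars e 2 ∧ I.vars g' s' ≠ I.vars e 3)) :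
    J₀.card ≤ 5 :=
  card_le_five_of_freshGates_aux I hI hT hS hB hF hP hmax hchord hne _ w₁ w₂ le_rfl ht hfresh

end Summit.PneNP.PneNP.Theorems.PstarFreshEraseGates
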